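import Literature.AlgebraicGeometry.Morphisms.EtaleLocusFibres
import Literature.AlgebraicGeometry.Resolution.AlterationsSeparableGenericallyEtale
import HarnessLib

/-!
# In characteristic `0`, a proper morphism with finite non-empty general fibres is finite étale over a dense open,
# and its fibres there are reduced (Harris Prop. 7.16; de Jong 2.20; EGA IV₄ 17.6.1)

Layer `Literature/AlgebraicGeometry/Morphisms`, namespace `Literature.AlgebraicGeometry.Morphisms`.  KERNEL ONLY: theorems;
no definition, no named fact, no instance, no `sorry`.  The JUNCTION of ★ `Morphisms/EtaleLocusFibres` (A-p07 (g14): alterations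
from finite non-empty closed fibres §3, fibres over the finite étale locus are reduced §2, socket §4 with the hypothesis `hcore`)
with ★ `Resolution/AlterationsSeparableGenericallyEtale` (A-p06 (g16): `IsAlteration.exists_isFinite_etale_morphismRestrict_of_charZero`,
de Jong 2.20 «separable ⇒ generically étale», characteristic `0`): the hypothesis `hcore` is DISCHARGED.

* `exists_opens_finite_etale_isReduced_of_charZero` — for `ψ : T ⟶ S` proper and locally of finite presentation between
  integral schemes, `S` Jacobson with `char K(S) = 0`, and a non-empty open `U ⊆ S` over whose closed points the fibres of `ψ`
  are finite and non-empty: there is a non-empty open `V ⊆ S` over which `ψ` is FINITE ÉTALE, every scheme-theoretic fibre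
  `ψ⁻¹(s)` (`s ∈ V`) is reduced, and every pull-back of `ψ` along a field-valued point landing in `V` is reduced.
* `isReduced_of_isPullback_of_charZero` — the same with the reduced fibre presented by ANY cartesian square (the currency of the
  (P3-iii) shear of the cell `hodgecm-mathlib` road (E)).

Consumer (cell `hodgecm-mathlib`, D-0151, road G4∕(E), [Lange2023AbelianVarietiesComplex] Lemma 4.4.4 Step I = [Milne1986JacobianVarieties]
Lemma 6.7 «multiplicity one»): the incidence `ψ : C × W̃_{g−1} → J`.  COUNT-NEUTRAL.  HC_CM is proved only modulo the 7
printed citations until rung 0 closes.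

## References
* [Harris1992] J. Harris, *Algebraic Geometry: A First Course*, GTM 133 (1992), Prop. 7.16 (p. 80).
* [DeJong1996] A. J. de Jong, *Smoothness, semi-stability and alterations*, Publ. Math. IHÉS 83 (1996), 2.20 (p. 61).
* [Grothendieck1967] A. Grothendieck, J. Dieudonné, EGA IV₄, Publ. Math. IHÉS 32 (1967), Thm. 17.6.1.
-/

set_option autoImplicit false

noncomputable section

universe u

open CategoryTheory CategoryTheory.Limits AlgebraicGeometry TopologicalSpace

namespace Literature.AlgebraicGeometry.Morphisms

variable {T S : Scheme.{u}} (ψ : T ⟶ S) [IsIntegral T] [IsIntegral S] [IsProper ψ] [LocallyOfFinitePresentation ψ]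
  [JacobsonSpace S] [CharZero S.functionField]

/-- **Characteristic `0`: finite non-empty general fibres ⇒ finite étale over a dense open, with reduced fibres.**  For
`ψ : T ⟶ S` proper and locally of finite presentation between integral schemes, `S` Jacobson with `char K(S) = 0`, and a
non-empty open `U ⊆ S` over whose CLOSED points the fibres of `ψ` are finite and non-empty, there is a non-empty open `V ⊆ S`
with `ψ ∣_ V` finite étale, all fibres `ψ⁻¹(s)`, `s ∈ V`, reduced, and all pull-backs along field-valued points of `V` reduced
(★ `exists_opens_finite_etale_isReduced_of_core` with `hcore` := ★ `IsAlteration.exists_isFinite_etale_morphismRestrict_of_charZero`).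
[cite: Harris1992, Prop. 7.16 (p. 80)] [cite: DeJong1996, 2.20, p. 61] [cite: Grothendieck1967, Thm. 17.6.1] -/
theorem exists_opens_finite_etale_isReduced_of_charZero (U : S.Opens) (hU : (U : Set S).Nonempty)
    (hfin : ∀ s : S, s ∈ U → IsClosed ({s} : Set S) → (ψ.base ⁻¹' {s}).Finite)
    (hne : ∀ s : S, s ∈ U → IsClosed ({s} : Set S) → (ψ.base ⁻¹' {s}).Nonempty) :
    ∃ V : S.Opens, (V : Set S).Nonempty ∧ IsFinite (ψ ∣_ V) ∧ Etale (ψ ∣_ V) ∧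
      (∀ s : S, s ∈ V → IsReduced (ψ.fiber s : Scheme.{u})) ∧
      ∀ (Ω : Type u) [Field Ω] (sb : Spec (.of Ω) ⟶ S),
        sb.base (IsLocalRing.closedPoint Ω) ∈ V → IsReduced (pullback ψ sb : Scheme.{u}) :=
  exists_opens_finite_etale_isReduced_of_core ψ
    (fun h => h.exists_isFinite_etale_morphismRestrict_of_charZero) U hU hfin hne

/-- **The same, with the reduced fibre presented by ANY cartesian square** `P = T ×_S Spec Ω` over a field-valued point of
the finite étale open `V` (the currency in which an incidence fibre is identified with a subscheme of the curve).
[cite: Harris1992, Prop. 7.16 (p. 80)] [cite: DeJong1996, 2.20, p. 61] -/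
theorem exists_opens_isReduced_of_isPullback_of_charZero (U : S.Opens) (hU : (U : Set S).Nonempty)
    (hfin : ∀ s : S, s ∈ U → IsClosed ({s} : Set S) → (ψ.base ⁻¹' {s}).Finite)
    (hne : ∀ s : S, s ∈ U → IsClosed ({s} : Set S) → (ψ.base ⁻¹' {s}).Nonempty) :
    ∃ V : S.Opens, (V : Set S).Nonempty ∧ IsFinite (ψ ∣_ V) ∧ Etale (ψ ∣_ V) ∧
      ∀ (Ω : Type u) [Field Ω] (sb : Spec (.of Ω) ⟶ S), sb.base (IsLocalRing.closedPoint Ω) ∈ V →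
        ∀ (P : Scheme.{u}) (t : P ⟶ T) (p : P ⟶ Spec (.of Ω)), IsPullback t p ψ sb → IsReduced P := by
  obtain ⟨V, hV, hfinV, hetV⟩ := (isAlteration_of_finite_nonempty_preimage_of_isClosed ψ U hU hfin
    hne).exists_isFinite_etale_morphismRestrict_of_charZero
  exact ⟨V, hV, hfinV, hetV, fun Ω _ sb hsb P t p sq =>
    isReduced_of_isPullback_of_range_subset ψ V (range_subset_of_apply_closedPoint_mem V sb hsb) sq⟩

end Literature.AlgebraicGeometry.Morphisms

end
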